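import Summits.QuantumFields.BalabanUV.T4Continuum.Support.NE3QuadRemainderLocal
import Literature.MathematicalPhysics.QuantumFieldTheory.Balaban1983to89.B7BlockAvgLog
import HarnessLib

/-!
# T⁴ programme, node NE3, route Π item Π-C (file Π-C-3d «FIBRE») — AT A FIBRE POINT THE LINEARISED AVERAGE IS MINUS THE QUADRATIC REMAINDER:
# `cavgIter L K (W·e^{X}) = cavgIter L K W  ⟹  relIter L K W X = 0`, hence `‖D_W^{(K)} X (z,κ)‖ = ‖C_W^{(K)}(X)(z,κ)‖ ≤ C₂·(L^K·sup_{B̃_K(z)}‖X‖)²`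

NE3 formalisation swarm `b2b-balaban-t4-ne3-formalise-*`, LEAF PROVER 02 (gen 7); the input «`D_W X₀ = −C_W(X₀)` exactly» of the owner's ν-letter
(D-ne3p1-g25-1 §1 (ii)∕§2, ρ-g25-2 (4): `l2sq_N (D_W X₀) = Σ‖C_W X₀‖² ≤ C₂²·M⁴·Σ m⁴`) made a kernel statement over Π-C-3b∕3c: if the varied configuration
`W·e^{X}` has the SAME K-fold average as `W` (the non-linear fibre equation of the residual slice representative, owner's
`NE3ResidualSliceRep.cavgIter_vary_eq_of_residualSliceRep`), then by Π-C-3b's consistency identity `vary (cavgIter L K W) (relIter L K W X) 1 = cavgIter L K W`,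
so `e^{relIter (z,κ)} = 1` with `‖relIter (z,κ)‖ ≤ 2(3+12d)L^K s < 1`, i.e. `relIter L K W X = 0` (Literature `B7BlockAvgLog.eq_zero_of_exp_eq_one` BY NAME),
and the END ∕ LOCAL END of Π-C bound the linearised average itself.

CONTENT (all [folklore]; 0 sorry; 0 def): `expUnit_eq_one_of_mul_eq`, **`relIter_eq_zero_of_fibre`**, **`norm_dirIter_le_of_fibre`** (global sup `s`),
**`norm_dirIter_le_of_fibre_local`** (local sup `t ≤ s` on the dependency ball `{y : l1 (y − L^K•z) ≤ depRad d L K}`).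

HONEST FRAMING.  Bookkeeping on OUR frame over landed ENDs; nothing about Bałaban's minimisers (the fibre equation is a HYPOTHESIS here — in route Π
it is the owner's `ResidualSliceRep`∕class transport); `DecomposedRep`'s sizes, T-E_w♯, NE3 NOT proved; spine PROVED 0∕9; finite T⁴ rung (B)+1 — NOT
infinite volume, NOT mass gap, NOT BetaPertH, NOT Clay.  ABSOLUTE RULE kept (context only: [Balaban1985Averaging] Prop. 4 p. 38; [Balaban1985Variational]
(44), (48)–(49) p. 285).  PLACEMENT: `Summits/QuantumFields/BalabanUV/`.  HONEST DEPENDENCY: continuum YM on T⁴ ⇐ BetaPertH ∧ nine spine estimates (0/9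
proved); BetaPertH ⇐ (D1) ∧ (D4) ∧ CAP+tail; G-an2-4 gates asym, D1 and NE2/3/4.
-/

set_option autoImplicit false

open scoped BigOperators Matrix.Norms.L2Operator
open NormedSpace Finset

namespace Summit.QuantumFields.BalabanUV.T4Continuum.NE3QuadRemainderFibre

open Literature.MathematicalPhysics.QuantumFieldTheory.Balaban1983to89
open B7Prop1Explicit B7Prop2Explicit
open T4AveragingDeficitWall (IsUnitaryCfg IsSkewDir SmallField vary)
open T4AveragingDeficitWallBoundary (IsPeriodicCfg)
open AveragingDeficitPeriodicCounting (IsPeriodicDir)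
open AveragingDeficitMultiLevelPrep (cavgIter LevelSmall)
open BlockAverageVaryDisc (rho0 rho0_pos)
open NE3TangentCovariantTower (dirIter)
open NE3LinearisedAverageSup (curvSum)
open NE3QuadRemainderTower (relIter)
open NE3QuadRemainderLocality (depRad)
open NE3QuadRemainderSup (norm_relIter_sub_dirIter_le norm_relIter_le cavgIter_vary_eq_vary_relIter_of_tower sigma_lines rho0_le_one)
open NE3QuadRemainderLocal (norm_relIter_sub_dirIter_le_local)

noncomputable section

variable {d : ℕ} {n : Type*} [Fintype n] [DecidableEq n]

/-- Cancelling a unit: `V = V·e^{A}` forces `e^{A} = 1`. [folklore] -/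
theorem exp_eq_one_of_mul_expUnit_eq {V : (Matrix n n ℂ)ˣ} {A : Matrix n n ℂ} (h : V * expUnit A = V) : exp A = 1 := by
  have h1 : expUnit A = 1 := mul_left_cancel (a := V) (by rw [h, mul_one])
  have h2 := congrArg (fun u : (Matrix n n ℂ)ˣ => (u : Matrix n n ℂ)) h1
  simpa only [val_expUnit, Units.val_one] using h2

/-- **AT A FIBRE POINT THE K-FOLD RELATIVE LOG-COORDINATE VANISHES.**  Under the tower-class hypotheses of Π-C-3b (`2 ≤ L`, `W` unitary
`(L^K·N)`-periodic, `0 ≤ x`, `LevelSmall d L K x`, `SmallField W x`, `curvSum d L K x ≤ (2∕3)L`), a skew `(L^K·N)`-periodic `X` with `‖X‖ ≤ s` and the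
smallness line `4(3+12d)²·L^K·s ≤ rho0²`: if `cavgIter L K (vary W X 1) = cavgIter L K W` then `relIter L K W X z κ = 0` for every bond.
[cite: Balaban1985Variational, (48)–(49) p.285] -/
theorem relIter_eq_zero_of_fibre [Nonempty n] {L N K : ℕ} [NeZero N] (hL : 2 ≤ L) {W : Site d → Fin d → (Matrix n n ℂ)ˣ} {x : ℝ}
    (hWu : IsUnitaryCfg W) (hWP : IsPeriodicCfg W ((L ^ K * N : ℕ) : ℤ)) (hx : 0 ≤ x) (hsm : LevelSmall d L K x) (hWx : SmallField W x)
    (hA : curvSum d L K x ≤ 2 / 3 * L) {X : Site d → Fin d → Matrix n n ℂ} (hXs : IsSkewDir X) (hXP : IsPeriodicDir X ((L ^ K * N : ℕ) : ℤ))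
    {s : ℝ} (hs : 0 ≤ s) (hX : ∀ (z : Site d) (μ : Fin d), ‖X z μ‖ ≤ s)
    (hσ : 4 * (3 + 12 * (d : ℝ)) ^ 2 * (L : ℝ) ^ K * s ≤ rho0 d L ^ 2)
    (hfib : cavgIter L K (vary W X 1) = cavgIter L K W) (z : Site d) (κ : Fin d) : relIter L K W X z κ = 0 := by
  have hc := cavgIter_vary_eq_vary_relIter_of_tower hL hWu hWP hx hsm hWx hA hXs hXP hs hX hσ (k := K) le_rfl
  rw [hfib] at hc
  -- bondwise: `cavgIter K W z κ = cavgIter K W z κ · e^{relIter z κ}`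
  have hb : cavgIter L K W z κ * expUnit (((1 : ℝ) : ℂ) • relIter L K W X z κ) = cavgIter L K W z κ := by
    have h := congrFun (congrFun hc z) κ
    exact h.symm
  rw [Complex.ofReal_one, one_smul] at hb
  have hexp : exp (relIter L K W X z κ) = 1 := exp_eq_one_of_mul_expUnit_eq hb
  -- the coordinate is small: `‖relIter‖ ≤ 2(3+12d)L^K s ≤ rho0/4 < 1`
  have hsmall : ‖relIter L K W X z κ‖ < 1 := by
    have h1 := norm_relIter_le hL hWu hWP hx hsm hWx hA hXs hXP hs hX hσ (k := K) le_rfl z κ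
    have h2 := (sigma_lines (d := d) hL hs hσ (i := K) le_rfl).1
    have h3 := rho0_le_one (d := d) (L := L) (by omega)
    linarith
  exact B7BlockAvgLog.eq_zero_of_exp_eq_one hsmall hexp

/-- **THE LINEARISED AVERAGE AT A FIBRE POINT IS QUADRATICALLY SMALL (global sup)**: under the same hypotheses,
`‖dirIter L K W X z κ‖ ≤ (4(3+12d)³∕rho0²)·(L^K·s)²` — i.e. `D_W X = −C_W(X)` read through Π-C-3b's END. [cite: Balaban1985Averaging, Prop. 4 (134)–(135) p.38] -/
theorem norm_dirIter_le_of_fibre [Nonempty n] {L N K : ℕ} [NeZero N] (hL : 2 ≤ L) {W : Site d → Fin d → (Matrix n n ℂ)ˣ} {x : ℝ}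
    (hWu : IsUnitaryCfg W) (hWP : IsPeriodicCfg W ((L ^ K * N : ℕ) : ℤ)) (hx : 0 ≤ x) (hsm : LevelSmall d L K x) (hWx : SmallField W x)
    (hA : curvSum d L K x ≤ 2 / 3 * L) {X : Site d → Fin d → Matrix n n ℂ} (hXs : IsSkewDir X) (hXP : IsPeriodicDir X ((L ^ K * N : ℕ) : ℤ))
    {s : ℝ} (hs : 0 ≤ s) (hX : ∀ (z : Site d) (μ : Fin d), ‖X z μ‖ ≤ s)
    (hσ : 4 * (3 + 12 * (d : ℝ)) ^ 2 * (L : ℝ) ^ K * s ≤ rho0 d L ^ 2)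
    (hfib : cavgIter L K (vary W X 1) = cavgIter L K W) (z : Site d) (κ : Fin d) :
    ‖dirIter L K W X z κ‖ ≤ 4 * (3 + 12 * (d : ℝ)) ^ 3 / rho0 d L ^ 2 * ((L : ℝ) ^ K * s) ^ 2 := by
  have h := norm_relIter_sub_dirIter_le hL hWu hWP hx hsm hWx hA hXs hXP hs hX hσ K le_rfl z κ
  rwa [relIter_eq_zero_of_fibre hL hWu hWP hx hsm hWx hA hXs hXP hs hX hσ hfib z κ, zero_sub, norm_neg] at h

/-- **THE LINEARISED AVERAGE AT A FIBRE POINT IS QUADRATICALLY SMALL, LOCALLY**: with a LOCAL sup `t` of `X` on the dependency ball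
`{y : l1 (y − L^K•z) ≤ depRad d L K}` (`0 ≤ t`, `4(3+12d)²·L^K·t ≤ rho0²`) in addition to the global data,
`‖dirIter L K W X z κ‖ ≤ (4(3+12d)³∕rho0²)·(L^K·t)²` — the blockwise input `‖D_W X₀ (z,κ)‖ ≤ C₂·(M·m z κ)²` of the ν-letter. [folklore] -/
theorem norm_dirIter_le_of_fibre_local [Nonempty n] {L N K : ℕ} [NeZero N] (hL : 2 ≤ L) {W : Site d → Fin d → (Matrix n n ℂ)ˣ} {x : ℝ}
    (hWu : IsUnitaryCfg W) (hWP : IsPeriodicCfg W ((L ^ K * N : ℕ) : ℤ)) (hx : 0 ≤ x) (hsm : LevelSmall d L K x) (hWx : SmallField W x)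
    (hA : curvSum d L K x ≤ 2 / 3 * L) {X : Site d → Fin d → Matrix n n ℂ} (hXs : IsSkewDir X) (hXP : IsPeriodicDir X ((L ^ K * N : ℕ) : ℤ))
    {s : ℝ} (hs : 0 ≤ s) (hX : ∀ (z : Site d) (μ : Fin d), ‖X z μ‖ ≤ s)
    (hσ : 4 * (3 + 12 * (d : ℝ)) ^ 2 * (L : ℝ) ^ K * s ≤ rho0 d L ^ 2)
    (hfib : cavgIter L K (vary W X 1) = cavgIter L K W) (z : Site d) {t : ℝ} (ht : 0 ≤ t)
    (hloc : ∀ (y : Site d) (μ : Fin d), l1 (y - ((L : ℤ) ^ K) • z) ≤ depRad d L K → ‖X y μ‖ ≤ t)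
    (hσt : 4 * (3 + 12 * (d : ℝ)) ^ 2 * (L : ℝ) ^ K * t ≤ rho0 d L ^ 2) (κ : Fin d) :
    ‖dirIter L K W X z κ‖ ≤ 4 * (3 + 12 * (d : ℝ)) ^ 3 / rho0 d L ^ 2 * ((L : ℝ) ^ K * t) ^ 2 := by
  have h := norm_relIter_sub_dirIter_le_local hL hWu hWP hx hsm hWx hA hXs hXP (k := K) le_rfl z ht hloc hσt κ
  rwa [relIter_eq_zero_of_fibre hL hWu hWP hx hsm hWx hA hXs hXP hs hX hσ hfib z κ, zero_sub, norm_neg] at h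

end

end Summit.QuantumFields.BalabanUV.T4Continuum.NE3QuadRemainderFibre
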